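import Summits.QuantumFields.BalabanUV.T4Continuum.Support.ShellMeasureWindowReachLive

/-!
# `T4Continuum.ShellMeasureWindowReachCollar` — audit γ3, THE COLLAR: the END's window-support binder for the restricted
# density `𝟙{u < θ}·F` from a SPLIT reading — the slot's OWN sub-threshold event windows the plaquettes of `□^∼`
# ((2.17)'s sup domain), the density's KEPT CO-TESTS window the collar `□^{∼4} ∖ □^∼` of the block ((2.16)'s domain)
(cell `pub-balaban`, sub-cell `t4`, spine estimate NE7c (node U5b); NE7c ROUND-2 crew, unit
`b2b-balaban-t4-ne7c-formalise-leaf-01` gen 8; own-initiative companion of row **S87** of the owner's table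
`t4/b2b-balaban-t4-ne7c-p1/LEAVES-NE7c-P1.md` (owner g32 `ShellMeasureWindowRestrict` p228621; f2 leaf-03-g6
`ShellMeasureLandauEndWindowRestrict` p229117; f3 leaf-08-g14 `ShellMeasureWindowReachLive` p229141), filed on this
seat's XREAD INFO 1 of S87 (journal «XREAD VERDICT … p228621», GAPS § C-ne7cleaf01g8-1); ADDITIVE — imports S87 f3
`ShellMeasureWindowReachLive` (hence S1 `ShellMeasureAxialReach`, S87 f1 `ShellMeasureWindowRestrict`) ONLY, used BY NAME;
[folklore]; 0 `def`, 0 `def … : Prop`, 0 sorry, 0 citation tags)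

HONEST FRAMING.  Finite four-torus programme, rung (B)+1 only — NOT infinite volume, NOT a mass gap, NOT the Clay
problem, NOT summit progress; (B), `BetaPertHyp`, (B^μ) not consumed.  NE7c (`T4IndicatorShell.ShellWeightBound`) is NOT
PRINTED in [Balaban 1983–89] and NOT PROVED; «NE7c ⇐ the named binders» (trigger c3).  Nothing printed is asserted:
[Balaban1988Convergent] (2.16)∕(2.17) LOCATE the shapes of the two displayed readings below, they are not citations; no
estimate of Bałaban's is discharged.  This file is configuration-level BOOKKEEPING (a union of two plaquette sets + S1's
reach fired on the box, through S87 f3's `dist1_section_le`).  HONEST DEPENDENCY (cell): continuum YM on T⁴ ⇐ BetaPertH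
∧ nine spine estimates (0/9 proved); BetaPertH ⇐ (D1) ∧ (D4) ∧ CAP+tail; G-an2-4 gates asym, D1 and NE2/3/4.

THE POINT (scope of γ3's reach reading; owner NOTE N-ne7cp1-g32-2, WALL-NE7c-P1 §2b rows `S`∕`hFsupp`∕`Jco`).  The
live-level ENDs display `hFsupp : F(fixTo T U₀ (V[Λ := y])) ≠ 0 ⟹ every block bond of y within 2 sin(S∕2) of the centre`
for the block `Λ` = bonds of the localization domain `□^{∼4}` of the slot's cube (B14 (2.16): `U_{k,□}(V_k) =
U(𝐁_k(□^{∼4}), …)` — the flat-centre dictionary `hudict`∕`hΦ0` needs the WHOLE domain trivial at the chart centre).  S87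
f1 reduces it to the restricted density `F′ := 𝟙{u < θ}·F` plus ONE reading `hreach : u(W) < θ ⟹ window`, and S87 f3
produces that reading from S1's reach on the box `[lo, hi] ⊇ □^{∼4}` and the displayed `hsmall : u(W) < θ ⟹ ALL box
plaquettes a-small`.  But the slot's tested variable is (2.17) `sup_{p ⊂ □^∼} |U_{k,□}(V_k, ∂p) − 1|` — the sup runs over
the fine plaquettes of `□^∼` (ONE cube layer around `□`), not of `□^{∼4}` (FOUR; page render p. 257 re-checked, GAPS §
C-ne7cleaf01g8-1): composed with average regularity ([Balaban1985Averaging] Props 1∕2 TYPE) the sub-threshold event bounds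
the unit plaquettes of the configuration on `□^∼` ONLY.  The plaquettes of the COLLAR `□^{∼4} ∖ □^∼` are small for a
different reason: the same term carries the (2.17)-indicators of the NEIGHBOURING cubes `□′ ⊂ Ω_k` with
`□′^∼ ∩ □^{∼4} ≠ ∅` (the product `∏_{□⊂Ω_k}`) and the `T_k` restrictions on `Ω_k` ([Balaban1989LargeFieldI] (1.3)–(1.9)
TYPE) — FACTORS OF THE DENSITY `F` of the slot's realized law (its kept co-tests `Jco`; the dropped ones go to SM-L6
(MR)_j), i.e. a SUPPORT property of `F`, not a consequence of `u < θ`.  Hence the honest located input is a PAIR: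
* (R-core) `hcore : u(W) < θ ⟹ PlaqSmallOn A a W` — `A` = the unit plaquettes of `□^∼` (own event; (2.17) ∘ [B7] TYPE);
* (R-collar) `hcollar : F(W) ≠ 0 ⟹ PlaqSmallOn B a W` — `B` ⊇ the unit plaquettes of `□^{∼4} ∖ □^∼` (kept co-tests);
with the cover `boxPlaqs lo hi ⊆ A ∪ B`.  From the pair, `F′ = 𝟙{u < θ}·F ≠ 0` at a comb-fixed section gives `u < θ` AND
`F ≠ 0`, hence ALL box plaquettes small, hence (S1 via S87 f3 `dist1_section_le`) the END's `hFsupp` for `F′` — LITERALLY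
the binder S76 f2 ∕ S80 take at `T := combBonds lo hi`, `U₀ := 1`, `c := fun _ => 1` (§3).  The reading S87 f2's END
`…_final_of_reach` should consume is accordingly the SUPPORT-RELATIVE reach `hreach′ : u(W′) < θ → F(W′) ≠ 0 → window`
(§3 `hreach'_of_core_collar`); its proof uses `hreach` at exactly one place, under `(𝟙{u<θ}·F)(W′) ≠ 0`, where `F(W′) ≠ 0`
is available (§1 `lt_and_ne_zero_of_indicator_ne_zero`) — a two-line twin on that row (offered on the journal), not here.
* §1 generic: `lt_and_ne_zero_of_indicator_ne_zero`, `support_of_indicator_two` (TWO-source form of S87 f1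
  `support_of_indicator_mul`).
* §2 `plaqSmallOn_of_cover` (two-set form of the LEVEL-0 PRECEDENT S2 `ShellMeasureWilsonStraddle.plaqSmallOn_of_cover`:
  there the OTHER cubes' co-tests cover the box outside `P_u` — the same mechanism, now at a live level) + the canonical
  cover `C ⊆ A ∪ (C ∖ A)` (core `A`, collar `C ∖ A`) as an `example`.
* §3 **`hFsupp_indicator_of_core_collar`** (sectionwise readings), `…_of_forall` (configuration-level readings),
  `…_linear` (radius `(d−1)·n·a ≤ 2S∕π`, `S ≤ π`), **`hreach'_of_core_collar`** (the support-relative reach).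
* §4 consistency: S87 f3's one-reading `hFsupp_indicator_of_plaqSmall` IS the case `B := ∅` of §3 (an `example`), and the
  one-reading `hreach` implies `hreach′` trivially (`hreach'_of_hreach`) — nothing landed is lost.
* §5 RULE G-1 (x1) (owner gen 32∕33, the S77 lesson): **`core_collar_family_inhabited`** — on ANY `d = 2` torus with `≥ 3`
  sites per direction the whole family {`hn`, `hΛbox`, `hΛcomb`, `ha`, `hrad`, `hcover`, `hcore`, `hcollar`} is JOINTLY inhabited
  with a NONEMPTY block (one box bond off the comb, as in leaf-10-g11's level-0 box witness), `a = 1∕4`, `S = 1`, and the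
  restricted density NONZERO at the trivial section — §3 fires non-vacuously; no new closure condition (no star, boundary map,
  stencil) is introduced beyond S87 f3's box data + the cover.
NOT HERE: the two readings themselves (located, displayed, asserted by nobody — c2: binders, no `def … : Prop`); which
neighbours' indicators a given (2.18)-term keeps near `∂Ω_k` ((W1)∕`LiveWindow` bookkeeping); the centre-monotonicity `hJ`
the kept co-tests owe inside `Jco` (an (S-i)-type located input per neighbour — displayed in the ENDs already); any
estimate of Bałaban's.  NOTHING in the countdown moves; NE7c NOT PROVED; spine PROVED 0∕9.
-/

noncomputable section

open Set

namespace Summit.QuantumFields.BalabanUV.T4Continuum.ShellMeasureWindowReachCollar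

open scoped ENNReal
open Literature.MathematicalPhysics.QuantumFieldTheory.Balaban1983to89
open T4AxialGaugeSmallField (boxPlaqs boxBonds)
open T4AxialGaugeFixing (combBonds)
open T4TreeGaugeFixing (fixTo)
open ShellMeasureWindowReachLive (dist1_section_le rad_of_linear hFsupp_indicator_of_plaqSmall)

/-! ## §1 The support of the restricted density has TWO sources -/

section Generic

variable {X : Type*}

/-- `(𝟙{u < θ}·F)(W) ≠ 0` gives BOTH `u W < θ` (the slot's own event) AND `F W ≠ 0` (the density's support — where its
kept co-tests live). [folklore] -/
theorem lt_and_ne_zero_of_indicator_ne_zero {F : X → ℝ≥0∞} {u : X → ℝ} {θ : ℝ} {W : X}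
    (h : ({x | u x < θ}.indicator F) W ≠ 0) : u W < θ ∧ F W ≠ 0 := by
  by_cases hu : u W < θ
  · refine ⟨hu, ?_⟩
    rwa [indicator_of_mem (show W ∈ {x | u x < θ} from hu)] at h
  · exact absurd (indicator_of_notMem (show W ∉ {x | u x < θ} from hu) F) h

/-- **TWO-SOURCE SUPPORT** (the split form of S87 f1 `ShellMeasureWindowRestrict.support_of_indicator_mul`): a property
`P₁` read off the sub-threshold event and a property `P₂` read off the support of `F` hold TOGETHER wherever
`𝟙{u < θ}·F ≠ 0`. [folklore] -/
theorem support_of_indicator_two {F : X → ℝ≥0∞} {u : X → ℝ} {θ : ℝ} {P₁ P₂ : X → Prop}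
    (hcore : ∀ W, u W < θ → P₁ W) (hcollar : ∀ W, F W ≠ 0 → P₂ W) :
    ∀ W, ({x | u x < θ}.indicator F) W ≠ 0 → P₁ W ∧ P₂ W := fun W h =>
  ⟨hcore W (lt_and_ne_zero_of_indicator_ne_zero h).1, hcollar W (lt_and_ne_zero_of_indicator_ne_zero h).2⟩

end Generic

/-! ## §2 Plaquette smallness from a core∕collar cover -/

section Plaq

variable {P : Params} {j : ℕ} {G : Type*} [GaugeGroup G]

/-- **COVER**: smallness on a core set `A` and on a collar set `B` covering `C` is smallness on `C` (the two-set form of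
the level-0 precedent S2 `ShellMeasureWilsonStraddle.plaqSmallOn_of_cover` — «every box plaquette outside the own test's
domain is tested by some kept co-test»; stated here for two sets to keep this file's import cone at S87 f3). [folklore] -/
theorem plaqSmallOn_of_cover {A B C : Set (Plaq P j)} (hC : C ⊆ A ∪ B) {a : ℝ} {U : GaugeField P j G}
    (hA : PlaqSmallOn A a U) (hB : PlaqSmallOn B a U) : PlaqSmallOn C a U :=
  fun p hp => (hC hp).elim (hA p) (hB p)

/-- the CANONICAL cover: any core `A` (the plaquettes of `□^∼`) and the collar `C ∖ A` (the rest of the box) cover `C` —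
the hypothesis `hcover` of §3 is inhabited for every choice of the core (Mathlib `le_sup_sdiff`). [folklore] -/
example (A C : Set (Plaq P j)) : C ⊆ A ∪ (C \ A) := fun p hp => by
  by_cases h : p ∈ A
  · exact Or.inl h
  · exact Or.inr ⟨hp, h⟩

end Plaq

/-! ## §3 The END's window-support binder for `𝟙{u < θ}·F` from the SPLIT reading -/

section Support

variable {P : Params} {j : ℕ} {G : Type*} [GaugeGroup G] [DecidableEq (PBond P j)]

/-- **THE END's `hFsupp` FOR `F′ := 𝟙{u < θ}·F` FROM THE CORE∕COLLAR PAIR (γ3, sectionwise).**  Box `[lo, hi]`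
(`hi ≤ lo + n`; the block `□^{∼4}`), chart bonds `Λ ⊆ boxBonds lo hi` disjoint from the axial comb, `0 ≤ a`, window radius
`(d−1)·n·a ≤ 2 sin(S∕2)`; plaquette sets `A` (core: `□^∼`'s unit plaquettes) and `B` (collar) with `boxPlaqs lo hi ⊆ A ∪ B`;
TWO DISPLAYED READINGS at comb-fixed sections — (R-core) `u < θ ⟹ A`-plaquettes `a`-small ((2.17)'s sup domain ∘ average
regularity; located, NOT asserted) and (R-collar) `F ≠ 0 ⟹ B`-plaquettes `a`-small (the density's kept co-tests: the
neighbouring cubes' indicators; located, NOT asserted).  CONCLUSION — LITERALLY the live-level END hosts' binder at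
`T := combBonds lo hi`, `U₀ := 1`, `c := fun _ => 1`, for the density `{W | u W < θ}.indicator F`:
`F′((V[Λ := y])[comb := 1]) ≠ 0 ⟹ ∀ b ∈ Λ, dist1 (((1 : GaugeField) b)⁻¹ · y_b) ≤ 2 sin(S∕2)`
(§1 two sources ∘ §2 cover ∘ S87 f3 `dist1_section_le`). [folklore] -/
theorem hFsupp_indicator_of_core_collar {lo hi : Fin P.d → ℤ} {n : ℕ} (hn : ∀ κ, hi κ ≤ lo κ + n)
    (Λ : Finset (PBond P j)) (hΛbox : ∀ b ∈ Λ, b ∈ boxBonds lo hi) (hΛcomb : Disjoint Λ (combBonds lo hi))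
    {a S : ℝ} (ha : 0 ≤ a) (hrad : ((P.d - 1 : ℕ) : ℝ) * n * a ≤ 2 * Real.sin (S / 2))
    {A B : Set (Plaq P j)} (hcover : boxPlaqs lo hi ⊆ A ∪ B)
    {u : GaugeField P j G → ℝ} {θ : ℝ} (F : GaugeField P j G → ℝ≥0∞)
    (hcore : ∀ (V : GaugeField P j G) (y : ↥Λ → G),
      u (fixTo (combBonds lo hi) 1 (Function.updateFinset V Λ y)) < θ →
        PlaqSmallOn A a (fixTo (combBonds lo hi) 1 (Function.updateFinset V Λ y)))
    (hcollar : ∀ (V : GaugeField P j G) (y : ↥Λ → G),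
      F (fixTo (combBonds lo hi) 1 (Function.updateFinset V Λ y)) ≠ 0 →
        PlaqSmallOn B a (fixTo (combBonds lo hi) 1 (Function.updateFinset V Λ y))) :
    ∀ (V : GaugeField P j G) (y : ↥Λ → G),
      ({W | u W < θ}.indicator F) (fixTo (combBonds lo hi) 1 (Function.updateFinset V Λ y)) ≠ 0 →
        ∀ b (hb : b ∈ Λ), dist1 (((1 : GaugeField P j G) b)⁻¹ * y ⟨b, hb⟩) ≤ 2 * Real.sin (S / 2) := by
  intro V y hF b hb
  obtain ⟨hu, hF0⟩ := lt_and_ne_zero_of_indicator_ne_zero hF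
  have hbox : PlaqSmallOn (boxPlaqs lo hi) a (fixTo (combBonds lo hi) 1 (Function.updateFinset V Λ y)) :=
    plaqSmallOn_of_cover hcover (hcore V y hu) (hcollar V y hF0)
  rw [show ((1 : GaugeField P j G) b)⁻¹ * y ⟨b, hb⟩ = y ⟨b, hb⟩ by
    simp [show (1 : GaugeField P j G) b = 1 from rfl]]
  exact (dist1_section_le hn Λ hΛbox hΛcomb ha V y hbox hb).trans hrad

/-- … with BOTH readings in configuration-level form (`∀ W`, gauge-invariant statements; only their comb-fixed sections
are used). [folklore] -/
theorem hFsupp_indicator_of_core_collar_of_forall {lo hi : Fin P.d → ℤ} {n : ℕ} (hn : ∀ κ, hi κ ≤ lo κ + n)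
    (Λ : Finset (PBond P j)) (hΛbox : ∀ b ∈ Λ, b ∈ boxBonds lo hi) (hΛcomb : Disjoint Λ (combBonds lo hi))
    {a S : ℝ} (ha : 0 ≤ a) (hrad : ((P.d - 1 : ℕ) : ℝ) * n * a ≤ 2 * Real.sin (S / 2))
    {A B : Set (Plaq P j)} (hcover : boxPlaqs lo hi ⊆ A ∪ B)
    {u : GaugeField P j G → ℝ} {θ : ℝ} (F : GaugeField P j G → ℝ≥0∞)
    (hcore : ∀ W : GaugeField P j G, u W < θ → PlaqSmallOn A a W)
    (hcollar : ∀ W : GaugeField P j G, F W ≠ 0 → PlaqSmallOn B a W) :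
    ∀ (V : GaugeField P j G) (y : ↥Λ → G),
      ({W | u W < θ}.indicator F) (fixTo (combBonds lo hi) 1 (Function.updateFinset V Λ y)) ≠ 0 →
        ∀ b (hb : b ∈ Λ), dist1 (((1 : GaugeField P j G) b)⁻¹ * y ⟨b, hb⟩) ≤ 2 * Real.sin (S / 2) :=
  hFsupp_indicator_of_core_collar hn Λ hΛbox hΛcomb ha hrad hcover F (fun _ _ hu => hcore _ hu)
    (fun _ _ hF => hcollar _ hF)

/-- … with the LINEAR radius `(d−1)·n·a ≤ 2S∕π`, `0 ≤ S ≤ π` (S87 f3 `rad_of_linear`; the owner's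
`S_j = (π∕2)(d−1)n_j·a`). [folklore] -/
theorem hFsupp_indicator_of_core_collar_linear {lo hi : Fin P.d → ℤ} {n : ℕ} (hn : ∀ κ, hi κ ≤ lo κ + n)
    (Λ : Finset (PBond P j)) (hΛbox : ∀ b ∈ Λ, b ∈ boxBonds lo hi) (hΛcomb : Disjoint Λ (combBonds lo hi))
    {a S : ℝ} (ha : 0 ≤ a) (hS : 0 ≤ S) (hSπ : S ≤ Real.pi) (hrad : ((P.d - 1 : ℕ) : ℝ) * n * a ≤ 2 * S / Real.pi)
    {A B : Set (Plaq P j)} (hcover : boxPlaqs lo hi ⊆ A ∪ B)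
    {u : GaugeField P j G → ℝ} {θ : ℝ} (F : GaugeField P j G → ℝ≥0∞)
    (hcore : ∀ (V : GaugeField P j G) (y : ↥Λ → G),
      u (fixTo (combBonds lo hi) 1 (Function.updateFinset V Λ y)) < θ →
        PlaqSmallOn A a (fixTo (combBonds lo hi) 1 (Function.updateFinset V Λ y)))
    (hcollar : ∀ (V : GaugeField P j G) (y : ↥Λ → G),
      F (fixTo (combBonds lo hi) 1 (Function.updateFinset V Λ y)) ≠ 0 →
        PlaqSmallOn B a (fixTo (combBonds lo hi) 1 (Function.updateFinset V Λ y))) :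
    ∀ (V : GaugeField P j G) (y : ↥Λ → G),
      ({W | u W < θ}.indicator F) (fixTo (combBonds lo hi) 1 (Function.updateFinset V Λ y)) ≠ 0 →
        ∀ b (hb : b ∈ Λ), dist1 (((1 : GaugeField P j G) b)⁻¹ * y ⟨b, hb⟩) ≤ 2 * Real.sin (S / 2) :=
  hFsupp_indicator_of_core_collar hn Λ hΛbox hΛcomb ha (rad_of_linear hS hSπ hrad) hcover F hcore hcollar

/-- **THE SUPPORT-RELATIVE REACH `hreach′`** (the reading S87 f2's END can honestly consume): from the core∕collar pair,
`u((V[Λ := y])[comb := 1]) < θ → F((V[Λ := y])[comb := 1]) ≠ 0 → ∀ b ∈ Λ, dist1 (((1 : GaugeField) b)⁻¹ · y_b) ≤ 2 sin(S∕2)`.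
S87 f2 `…_final_of_reach` uses its `hreach` at one place, under `(𝟙{u<θ}·F)(…) ≠ 0`, where `F(…) ≠ 0` is at hand
(§1) — so `hreach′` serves there by a two-line twin. [folklore] -/
theorem hreach'_of_core_collar {lo hi : Fin P.d → ℤ} {n : ℕ} (hn : ∀ κ, hi κ ≤ lo κ + n)
    (Λ : Finset (PBond P j)) (hΛbox : ∀ b ∈ Λ, b ∈ boxBonds lo hi) (hΛcomb : Disjoint Λ (combBonds lo hi))
    {a S : ℝ} (ha : 0 ≤ a) (hrad : ((P.d - 1 : ℕ) : ℝ) * n * a ≤ 2 * Real.sin (S / 2))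
    {A B : Set (Plaq P j)} (hcover : boxPlaqs lo hi ⊆ A ∪ B)
    {u : GaugeField P j G → ℝ} {θ : ℝ} (F : GaugeField P j G → ℝ≥0∞)
    (hcore : ∀ (V : GaugeField P j G) (y : ↥Λ → G),
      u (fixTo (combBonds lo hi) 1 (Function.updateFinset V Λ y)) < θ →
        PlaqSmallOn A a (fixTo (combBonds lo hi) 1 (Function.updateFinset V Λ y)))
    (hcollar : ∀ (V : GaugeField P j G) (y : ↥Λ → G),
      F (fixTo (combBonds lo hi) 1 (Function.updateFinset V Λ y)) ≠ 0 →
        PlaqSmallOn B a (fixTo (combBonds lo hi) 1 (Function.updateFinset V Λ y))) :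
    ∀ (V : GaugeField P j G) (y : ↥Λ → G), u (fixTo (combBonds lo hi) 1 (Function.updateFinset V Λ y)) < θ →
      F (fixTo (combBonds lo hi) 1 (Function.updateFinset V Λ y)) ≠ 0 →
        ∀ b (hb : b ∈ Λ), dist1 (((1 : GaugeField P j G) b)⁻¹ * y ⟨b, hb⟩) ≤ 2 * Real.sin (S / 2) := by
  intro V y hu hF0 b hb
  have hbox : PlaqSmallOn (boxPlaqs lo hi) a (fixTo (combBonds lo hi) 1 (Function.updateFinset V Λ y)) :=
    plaqSmallOn_of_cover hcover (hcore V y hu) (hcollar V y hF0)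
  rw [show ((1 : GaugeField P j G) b)⁻¹ * y ⟨b, hb⟩ = y ⟨b, hb⟩ by
    simp [show (1 : GaugeField P j G) b = 1 from rfl]]
  exact (dist1_section_le hn Λ hΛbox hΛcomb ha V y hbox hb).trans hrad

/-- the support-relative reach gives the END's `hFsupp` for `𝟙{u < θ}·F` for ANY tree `T`, values `U₀`, chart bonds `Λ`
and centre `c` (the abstract form of the END hosts; no box geometry): the only use S87 f2 makes of its `hreach`. [folklore] -/
theorem hFsupp_indicator_of_hreach' {T Λ : Finset (PBond P j)} {U₀ : GaugeField P j G}
    {c : GaugeField P j G → GaugeField P j G} {r : ℝ} {u : GaugeField P j G → ℝ} {θ : ℝ}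
    (F : GaugeField P j G → ℝ≥0∞)
    (hreach' : ∀ (V : GaugeField P j G) (y : ↥Λ → G), u (fixTo T U₀ (Function.updateFinset V Λ y)) < θ →
      F (fixTo T U₀ (Function.updateFinset V Λ y)) ≠ 0 →
        ∀ b (hb : b ∈ Λ), dist1 ((c V b)⁻¹ * y ⟨b, hb⟩) ≤ r) :
    ∀ (V : GaugeField P j G) (y : ↥Λ → G),
      ({W | u W < θ}.indicator F) (fixTo T U₀ (Function.updateFinset V Λ y)) ≠ 0 →
        ∀ b (hb : b ∈ Λ), dist1 ((c V b)⁻¹ * y ⟨b, hb⟩) ≤ r := fun V y hF =>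
  hreach' V y (lt_and_ne_zero_of_indicator_ne_zero hF).1 (lt_and_ne_zero_of_indicator_ne_zero hF).2

end Support

/-! ## §4 Consistency with S87 f2∕f3: nothing landed is lost -/

section Consistency

variable {P : Params} {j : ℕ} {G : Type*} [GaugeGroup G] [DecidableEq (PBond P j)]

/-- the ONE-reading reach of S87 f2∕f3 (`u < θ ⟹ window`, F-blind) trivially gives the support-relative reach — the twin
`…_of_reach′` would therefore SUBSUME `…_of_reach`. [folklore] -/
theorem hreach'_of_hreach {T Λ : Finset (PBond P j)} {U₀ : GaugeField P j G} {c : GaugeField P j G → GaugeField P j G}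
    {r : ℝ} {u : GaugeField P j G → ℝ} {θ : ℝ} (F : GaugeField P j G → ℝ≥0∞)
    (hreach : ∀ (V : GaugeField P j G) (y : ↥Λ → G), u (fixTo T U₀ (Function.updateFinset V Λ y)) < θ →
      ∀ b (hb : b ∈ Λ), dist1 ((c V b)⁻¹ * y ⟨b, hb⟩) ≤ r) :
    ∀ (V : GaugeField P j G) (y : ↥Λ → G), u (fixTo T U₀ (Function.updateFinset V Λ y)) < θ →
      F (fixTo T U₀ (Function.updateFinset V Λ y)) ≠ 0 → ∀ b (hb : b ∈ Λ), dist1 ((c V b)⁻¹ * y ⟨b, hb⟩) ≤ r :=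
  fun V y hu _ => hreach V y hu

/-- S87 f3's ONE-reading `hFsupp_indicator_of_plaqSmall` IS §3 at the empty collar `B := ∅` (core `A := boxPlaqs lo hi`,
`hcollar` vacuous): the split form generalises the landed one. [folklore] -/
example {lo hi : Fin P.d → ℤ} {n : ℕ} (hn : ∀ κ, hi κ ≤ lo κ + n)
    (Λ : Finset (PBond P j)) (hΛbox : ∀ b ∈ Λ, b ∈ boxBonds lo hi) (hΛcomb : Disjoint Λ (combBonds lo hi))
    {a S : ℝ} (ha : 0 ≤ a) (hrad : ((P.d - 1 : ℕ) : ℝ) * n * a ≤ 2 * Real.sin (S / 2))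
    {u : GaugeField P j G → ℝ} {θ : ℝ}
    (hsmall : ∀ (V : GaugeField P j G) (y : ↥Λ → G),
      u (fixTo (combBonds lo hi) 1 (Function.updateFinset V Λ y)) < θ →
        PlaqSmallOn (boxPlaqs lo hi) a (fixTo (combBonds lo hi) 1 (Function.updateFinset V Λ y)))
    (F : GaugeField P j G → ℝ≥0∞) :
    ∀ (V : GaugeField P j G) (y : ↥Λ → G),
      ({W | u W < θ}.indicator F) (fixTo (combBonds lo hi) 1 (Function.updateFinset V Λ y)) ≠ 0 →
        ∀ b (hb : b ∈ Λ), dist1 (((1 : GaugeField P j G) b)⁻¹ * y ⟨b, hb⟩) ≤ 2 * Real.sin (S / 2) :=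
  hFsupp_indicator_of_core_collar hn Λ hΛbox hΛcomb ha hrad (A := boxPlaqs lo hi) (B := ∅) (by simp) F hsmall
    (fun _ _ _ p hp => absurd hp (Set.notMem_empty p))

/-- … and conversely S87 f3's lemma is recovered BY NAME from the same data (the two files agree on the one-reading case).
[folklore] -/
example {lo hi : Fin P.d → ℤ} {n : ℕ} (hn : ∀ κ, hi κ ≤ lo κ + n)
    (Λ : Finset (PBond P j)) (hΛbox : ∀ b ∈ Λ, b ∈ boxBonds lo hi) (hΛcomb : Disjoint Λ (combBonds lo hi))
    {a S : ℝ} (ha : 0 ≤ a) (hrad : ((P.d - 1 : ℕ) : ℝ) * n * a ≤ 2 * Real.sin (S / 2))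
    {u : GaugeField P j G → ℝ} {θ : ℝ}
    (hsmall : ∀ (V : GaugeField P j G) (y : ↥Λ → G),
      u (fixTo (combBonds lo hi) 1 (Function.updateFinset V Λ y)) < θ →
        PlaqSmallOn (boxPlaqs lo hi) a (fixTo (combBonds lo hi) 1 (Function.updateFinset V Λ y)))
    (F : GaugeField P j G → ℝ≥0∞) :
    ∀ (V : GaugeField P j G) (y : ↥Λ → G),
      ({W | u W < θ}.indicator F) (fixTo (combBonds lo hi) 1 (Function.updateFinset V Λ y)) ≠ 0 →
        ∀ b (hb : b ∈ Λ), dist1 (((1 : GaugeField P j G) b)⁻¹ * y ⟨b, hb⟩) ≤ 2 * Real.sin (S / 2) :=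
  hFsupp_indicator_of_plaqSmall hn Λ hΛbox hΛcomb ha hrad hsmall F

end Consistency

/-! ## §5 RULE G-1 (x1): the hypothesis family of §3 is JOINTLY INHABITED with `Λ ≠ ∅` and a live section -/

section Witness

variable {P : Params} {j : ℕ} {G : Type*} [GaugeGroup G] [DecidableEq (PBond P j)]

open T4AxialGaugeSmallField (castSite castSite_injOn_box)
open T4AxialGaugeFixing (combSet mem_combBonds)
open T4SmallFieldWindowSandwich (plaqSmallOn_one)
open T4TreeGaugeFixing (fixTo_apply_of_mem fixTo_apply_of_not_mem)
open T4TiltOscillation (updateFinset_apply_of_mem)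
open B7Prop1Explicit (e e_apply)
open B8Lemma1NonAbelian (lowPart lowPart_apply e_nonneg)

/-- **(x1) JOINT INHABITATION OF §3's FAMILY ON A `d = 2` TORUS, `Λ ≠ ∅`, WITH A LIVE SECTION** (CREW RULE G-1, owner gen 32∕33;
the S77 lesson F-ne7cleaf02g9-1).  On any two-dimensional torus with `≥ 3` sites per direction, any corner `lo`, the side-2
box `hi := lo + 2` (`n = 2`), the ONE-bond block `Λ := {⟨castSite (lo + e₀), 1⟩}` (a box bond OFF the axial comb — its offset
from the corner has low part `e₀ ≠ 0` below direction `1`; non-wrapping makes the box preimage unique, as in leaf-10-g11's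
level-0 box witness), threshold `a := 1∕4`, window `S := 1` (`2·(1∕4) ≤ 2 sin(1∕2)`), core `A :=` the corner plaquette, collar
`B :=` all box plaquettes, the reading-shaped tested variable `u W := if A is a-small then 0 else 1` (`θ := 1`) and density
`F := 𝟙{B is a-small}`: ALL of `hn`, `hΛbox`, `hΛcomb`, `ha`, `hrad`, `hcover`, `hcore`, `hcollar` hold, `Λ` is NONEMPTY, and
the restricted density is NONZERO at the trivial section (`V := 1`, `y := 1`) — so §3's conclusion is met non-vacuously there
(every block bond of that section within `2 sin(S∕2)` of `1`). [folklore] -/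
theorem core_collar_family_inhabited (hd : P.d = 2) (h3 : 3 ≤ P.sitesPerDir j) (lo : Fin P.d → ℤ) :
    ∃ (hi : Fin P.d → ℤ) (n : ℕ) (Λ : Finset (PBond P j)) (a S θ : ℝ) (A B : Set (Plaq P j))
      (u : GaugeField P j G → ℝ) (F : GaugeField P j G → ℝ≥0∞),
      Λ.Nonempty ∧ (∀ κ, hi κ ≤ lo κ + n) ∧ (∀ b ∈ Λ, b ∈ boxBonds lo hi) ∧ Disjoint Λ (combBonds lo hi) ∧ 0 ≤ a ∧
      ((P.d - 1 : ℕ) : ℝ) * n * a ≤ 2 * Real.sin (S / 2) ∧ boxPlaqs lo hi ⊆ A ∪ B ∧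
      (∀ W : GaugeField P j G, u W < θ → PlaqSmallOn A a W) ∧ (∀ W : GaugeField P j G, F W ≠ 0 → PlaqSmallOn B a W) ∧
      (∃ (V : GaugeField P j G) (y : ↥Λ → G),
        ({W | u W < θ}.indicator F) (fixTo (combBonds lo hi) 1 (Function.updateFinset V Λ y)) ≠ 0) ∧
      (∀ (V : GaugeField P j G) (y : ↥Λ → G),
        ({W | u W < θ}.indicator F) (fixTo (combBonds lo hi) 1 (Function.updateFinset V Λ y)) ≠ 0 →
          ∀ b (hb : b ∈ Λ), dist1 (((1 : GaugeField P j G) b)⁻¹ * y ⟨b, hb⟩) ≤ 2 * Real.sin (S / 2)) := by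
  classical
  -- the two directions and the box
  set i₀ : Fin P.d := ⟨0, by omega⟩ with hi₀
  set i₁ : Fin P.d := ⟨1, by omega⟩ with hi₁
  have h01 : i₀ < i₁ := Fin.mk_lt_mk.2 (by norm_num)
  set hi : Fin P.d → ℤ := fun κ => lo κ + 2 with hhi
  have hN : ∀ κ, hi κ - lo κ < P.sitesPerDir j := fun κ => by
    have : (3 : ℤ) ≤ (P.sitesPerDir j : ℤ) := by exact_mod_cast h3
    simp only [hhi]; linarith
  have hsq : lo + e i₀ + e i₁ ≤ hi := fun κ => by
    simp only [hhi, Pi.add_apply, e_apply]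
    have hne : i₀ ≠ i₁ := ne_of_lt h01
    split_ifs with h1 h2 <;> omega
  have hle' : lo + e i₀ ≤ hi := fun κ => by
    have h1 := hsq κ; simp only [Pi.add_apply] at h1 ⊢; linarith [show (0 : ℤ) ≤ e i₁ κ by simpa only [Pi.zero_apply] using e_nonneg (d := P.d) i₁ κ]
  have hlo : lo ≤ lo + e i₀ := fun κ => by
    simpa only [Pi.add_apply] using le_add_of_nonneg_right (show (0 : ℤ) ≤ e i₀ κ by simpa only [Pi.zero_apply] using e_nonneg (d := P.d) i₀ κ)
  -- the block: ONE bond off the comb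
  set b₀ : PBond P j := ⟨castSite (lo + e i₀), i₁⟩ with hb₀
  have hbox : b₀ ∈ boxBonds lo hi := ⟨lo + e i₀, hlo, hsq, rfl⟩
  have hcomb : b₀ ∉ combBonds lo hi := by
    intro hc
    obtain ⟨x, hlox, hxhi, hsrc, hlow⟩ := mem_combBonds.1 hc
    have hxle : x ≤ hi := fun κ => by
      have h1 := hxhi κ; simp only [Pi.add_apply] at h1; linarith [show (0 : ℤ) ≤ e i₁ κ by simpa only [Pi.zero_apply] using e_nonneg (d := P.d) i₁ κ]
    have hx : x = lo + e i₀ := castSite_injOn_box hN hlox hxle hlo hle' hsrc.symm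
    have h := congr_fun hlow i₀
    rw [hx, lowPart_apply, if_pos h01] at h
    simp [e_apply] at h
  -- the plaquette sets, the readings
  set p₀ : Plaq P j := ⟨castSite lo, i₀, i₁, h01⟩ with hp₀
  set A : Set (Plaq P j) := {p₀} with hA
  set B : Set (Plaq P j) := boxPlaqs lo hi with hB
  set a : ℝ := 1 / 4 with ha
  set u : GaugeField P j G → ℝ := fun W => if PlaqSmallOn A a W then 0 else 1 with hu
  set F : GaugeField P j G → ℝ≥0∞ := {W | PlaqSmallOn B a W}.indicator 1 with hF
  have hcore : ∀ W : GaugeField P j G, u W < 1 → PlaqSmallOn A a W := fun W hW => by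
    by_contra hnot
    simp only [hu, if_neg hnot, lt_self_iff_false] at hW
  have hcollar : ∀ W : GaugeField P j G, F W ≠ 0 → PlaqSmallOn B a W := fun W hW => by
    by_contra hnot
    exact hW (indicator_of_notMem (show W ∉ {W | PlaqSmallOn B a W} from hnot) _)
  -- the radius: `(2 − 1)·2·(1∕4) ≤ 2 sin(1∕2)`
  have hrad : ((P.d - 1 : ℕ) : ℝ) * (2 : ℕ) * a ≤ 2 * Real.sin ((1 : ℝ) / 2) := by
    have hsin : (1 : ℝ) / 2 - (1 / 2) ^ 3 / 6 < Real.sin (1 / 2) := Real.sin_gt_sub_cube (by norm_num)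
    rw [hd]; norm_num [ha] at hsin ⊢; linarith
  have hcover : boxPlaqs lo hi ⊆ A ∪ B := fun p hp => Or.inr hp
  -- the trivial section is the trivial configuration
  have hsec : fixTo (combBonds lo hi) 1 (Function.updateFinset (1 : GaugeField P j G) {b₀} fun _ => 1) = 1 := by
    funext b
    by_cases hbT : b ∈ combBonds lo hi
    · rw [fixTo_apply_of_mem hbT]
    · rw [fixTo_apply_of_not_mem hbT]
      by_cases hbΛ : b ∈ ({b₀} : Finset (PBond P j))
      · rw [updateFinset_apply_of_mem _ _ hbΛ]; rfl
      · simp [Function.updateFinset, hbΛ]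
  have h14 : (0 : ℝ) < 1 / 4 := by norm_num
  have hF1 : F 1 ≠ 0 := by
    rw [hF, indicator_of_mem (show (1 : GaugeField P j G) ∈ {W | PlaqSmallOn B a W} from plaqSmallOn_one B h14)]
    simp
  have hu1 : u 1 < 1 := by
    show (if PlaqSmallOn A a (1 : GaugeField P j G) then (0 : ℝ) else 1) < 1
    rw [if_pos (plaqSmallOn_one A h14)]; norm_num
  refine ⟨hi, 2, {b₀}, a, 1, 1, A, B, u, F, Finset.singleton_nonempty _, fun κ => by simp [hhi],
    fun b hb => by rwa [Finset.mem_singleton.1 hb], Finset.disjoint_singleton_left.2 hcomb, h14.le, hrad, hcover, hcore,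
    hcollar, ⟨1, fun _ => 1, ?_⟩, ?_⟩
  · rw [hsec, indicator_of_mem (show (1 : GaugeField P j G) ∈ {W | u W < 1} from hu1)]
    exact hF1
  · exact hFsupp_indicator_of_core_collar_of_forall (fun κ => by simp [hhi]) {b₀}
      (fun b hb => by rwa [Finset.mem_singleton.1 hb]) (Finset.disjoint_singleton_left.2 hcomb) h14.le hrad hcover F
      hcore hcollar

end Witness

end Summit.QuantumFields.BalabanUV.T4Continuum.ShellMeasureWindowReachCollar

end
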